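import Literature.Analysis.Calculus.SmoothCutoff
import Mathlib.MeasureTheory.Integral.Prod
import Mathlib.MeasureTheory.Integral.IntervalIntegral.FundThmCalculus
import Summits.AtomisticToContinuum.HydrodynamicLimit.Theorems.JaynesSqueezeEntropicWeakStrongHSShellA
import HarnessLib

/-!
# BF18 shell for functions (crux `ChaosClosesEuler`, stmt-AtomisticToContinuum-15141, line `Sketch`,
# stub `stub_bf18Shell`) — helper 2a: the window cut-offs and their weights

WHAT. The time cut-off of the shell's windowed entropy input is `s ↦ ζ((τ₀ + Δ − s)/Δ)` (`ζ = Real.smoothTransition`),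
equal to `1` for `s ≤ τ₀` and to `0` for `s ≥ τ₀ + Δ`; its weight `w_{τ₀}(s) = −∂ₛ ζ((τ₀+Δ−s)/Δ) = ζ'(·)/Δ` is a smooth
probability density on the window. This file: the derivative formulas (`hasDerivAt_cut_s`, `hasDerivAt_cut_tau`,
`neg_deriv_cut_eq`), the KEY IDENTITY `∫_{τ'∈[α,β]} w_{τ'}(s) dτ' = ζ((β+Δ−s)/Δ) − ζ((α+Δ−s)/Δ)` (`integral_weight_tau`;
the right side is `≡ 1` on `[α+Δ, β]`), its Fubini form against a bounded measurable `F` (`integral_integral_weight`),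
and the weighted lower bound `m ∫_J F ≤ ∫ (ζ_β − ζ_α) F` whenever the averaged weight is `≥ m` on `J`
(`weighted_lower_bound`). Consumed by the windowed Grönwall lemma (helper 2b, `window_gronwall`).

WHY. The entropy input of the shell is tested against `θ̃(s,x)·ζ((τ₀+Δ−s)/Δ)` only (fixed tests, in-probability
antecedents), so the relative-energy inequality arrives averaged against `w_{τ₀}`; averaging the window STARTS is
what recovers plain time integrals.

No named fact is invoked.
-/

noncomputable section

namespace Summit.AtomisticToContinuum.HydrodynamicLimit.Theorems.ChaosClosesEulerShell

open Set MeasureTheory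
open scoped Topology

/-! ## The cut-off profile and its weights -/

/-- The `s`-derivative of the cut-off `s ↦ ζ((τ' + Δ − s)/Δ)`. [folklore] -/
theorem hasDerivAt_cut_s (τ' Δ s : ℝ) :
    HasDerivAt (fun s' => Real.smoothTransition ((τ' + Δ - s') / Δ))
      (deriv Real.smoothTransition ((τ' + Δ - s) / Δ) * (-(1 / Δ))) s := by
  have hg : HasDerivAt (fun s' : ℝ => (τ' + Δ - s') / Δ) (-(1 / Δ)) s := by
    have h1 : HasDerivAt (fun s' : ℝ => τ' + Δ - s') (-1) s := by
      simpa using (hasDerivAt_id s).const_sub (τ' + Δ)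
    have := h1.div_const Δ
    simpa [neg_div] using this
  exact (Literature.Analysis.Calculus.differentiable_smoothTransition _).hasDerivAt.comp s hg

/-- The `τ'`-derivative of the cut-off `τ' ↦ ζ((τ' + Δ − s)/Δ)`. [folklore] -/
theorem hasDerivAt_cut_tau (τ' Δ s : ℝ) :
    HasDerivAt (fun τ'' => Real.smoothTransition ((τ'' + Δ - s) / Δ))
      (deriv Real.smoothTransition ((τ' + Δ - s) / Δ) * (1 / Δ)) τ' := by
  have hg : HasDerivAt (fun τ'' : ℝ => (τ'' + Δ - s) / Δ) (1 / Δ) τ' := by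
    have h1 : HasDerivAt (fun τ'' : ℝ => τ'' + Δ - s) 1 τ' := by
      simpa using ((hasDerivAt_id τ').add_const Δ).sub_const s
    simpa using h1.div_const Δ
  exact (Literature.Analysis.Calculus.differentiable_smoothTransition _).hasDerivAt.comp τ' hg

/-- The weight `w_{τ'}(s) = −∂ₛ ζ((τ'+Δ−s)/Δ) = ζ'((τ'+Δ−s)/Δ)/Δ`. [folklore] -/
theorem neg_deriv_cut_eq (τ' Δ s : ℝ) :
    -deriv (fun s' => Real.smoothTransition ((τ' + Δ - s') / Δ)) s =
      deriv Real.smoothTransition ((τ' + Δ - s) / Δ) / Δ := by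
  rw [(hasDerivAt_cut_s τ' Δ s).deriv]; ring

/-- **Integrating the weights over the window start**: `∫_{τ'∈[α,β]} w_{τ'}(s) dτ' = ζ((β+Δ−s)/Δ) − ζ((α+Δ−s)/Δ)`
for `α ≤ β`. [folklore] -/
theorem integral_weight_tau {α β : ℝ} (hαβ : α ≤ β) (Δ s : ℝ) :
    ∫ τ' in Icc α β, -deriv (fun s' => Real.smoothTransition ((τ' + Δ - s') / Δ)) s =
      Real.smoothTransition ((β + Δ - s) / Δ) - Real.smoothTransition ((α + Δ - s) / Δ) := by
  simp_rw [neg_deriv_cut_eq]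
  rw [integral_Icc_eq_integral_Ioc, ← intervalIntegral.integral_of_le hαβ]
  have hderiv : ∀ τ' ∈ uIcc α β, HasDerivAt (fun τ'' => Real.smoothTransition ((τ'' + Δ - s) / Δ))
      (deriv Real.smoothTransition ((τ' + Δ - s) / Δ) / Δ) τ' := fun τ' _ => by
    have := hasDerivAt_cut_tau τ' Δ s
    simpa [mul_one_div, div_eq_mul_inv] using this
  have hc : Continuous (deriv Real.smoothTransition) :=
    (Real.smoothTransition.contDiff (n := 1)).continuous_deriv le_rfl
  have hcont : Continuous fun τ' => deriv Real.smoothTransition ((τ' + Δ - s) / Δ) / Δ :=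
    (hc.comp (by fun_prop)).div_const Δ
  exact intervalIntegral.integral_eq_sub_of_hasDerivAt hderiv (hcont.intervalIntegrable _ _)

/-- The weights are jointly continuous in `(τ', s)`. [folklore] -/
theorem continuous_weight (Δ : ℝ) :
    Continuous fun p : ℝ × ℝ =>
      -deriv (fun s' => Real.smoothTransition ((p.1 + Δ - s') / Δ)) p.2 := by
  have : (fun p : ℝ × ℝ => -deriv (fun s' => Real.smoothTransition ((p.1 + Δ - s') / Δ)) p.2) =
      fun p : ℝ × ℝ => deriv Real.smoothTransition ((p.1 + Δ - p.2) / Δ) / Δ := by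
    funext p; exact neg_deriv_cut_eq p.1 Δ p.2
  rw [this]
  have hc : Continuous (deriv Real.smoothTransition) :=
    (Real.smoothTransition.contDiff (n := 1)).continuous_deriv le_rfl
  exact (hc.comp (by fun_prop)).div_const Δ

/-- The weights are bounded on every compact rectangle `[α, β] × [0, t]`. [folklore] -/
theorem exists_weight_bound (α β t Δ : ℝ) :
    ∃ K : ℝ, 0 ≤ K ∧ ∀ τ' ∈ Icc α β, ∀ s ∈ Icc 0 t,
      |(-deriv (fun s' => Real.smoothTransition ((τ' + Δ - s') / Δ)) s)| ≤ K := by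
  obtain ⟨K, hK⟩ := (isCompact_Icc.prod isCompact_Icc : IsCompact (Icc α β ×ˢ Icc (0 : ℝ) t)).exists_bound_of_continuousOn
    ((continuous_weight Δ).continuousOn)
  refine ⟨max K 0, le_max_right _ _, fun τ' hτ' s hs => ?_⟩
  have := hK (τ', s) ⟨hτ', hs⟩
  rw [Real.norm_eq_abs] at this
  exact this.trans (le_max_left _ _)

/-! ## Fubini for the weights -/

/-- **Averaging the weighted integrals over the window start.** For a bounded measurable `F` and `α ≤ β`:
`∫_{τ'∈[α,β]} ∫_{s∈[0,t]} w_{τ'}(s) F(s) = ∫_{s∈[0,t]} (ζ((β+Δ−s)/Δ) − ζ((α+Δ−s)/Δ)) F(s)`, and the inner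
weighted integral is an integrable function of `τ'` on `[α, β]`. [folklore] -/
theorem integral_integral_weight {F : ℝ → ℝ} (hF : Measurable F) {C₂ : ℝ} (hFb : ∀ s, |F s| ≤ C₂)
    {α β : ℝ} (hαβ : α ≤ β) (t Δ : ℝ) :
    IntegrableOn (fun τ' => ∫ s in Icc 0 t,
        -deriv (fun s' => Real.smoothTransition ((τ' + Δ - s') / Δ)) s * F s) (Icc α β) volume ∧
    ∫ τ' in Icc α β, ∫ s in Icc 0 t,
        -deriv (fun s' => Real.smoothTransition ((τ' + Δ - s') / Δ)) s * F s =
      ∫ s in Icc 0 t, (Real.smoothTransition ((β + Δ - s) / Δ) -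
        Real.smoothTransition ((α + Δ - s) / Δ)) * F s := by
  set W : ℝ × ℝ → ℝ := fun p => -deriv (fun s' => Real.smoothTransition ((p.1 + Δ - s') / Δ)) p.2
    with hW
  have hWc : Continuous W := continuous_weight Δ
  obtain ⟨K, hK0, hK⟩ := exists_weight_bound α β t Δ
  have hC₂ : 0 ≤ C₂ := (abs_nonneg _).trans (hFb 0)
  -- the integrand on the product
  set f : ℝ × ℝ → ℝ := fun p => W p * F p.2 with hf
  have hfm : Measurable f := hWc.measurable.mul (hF.comp measurable_snd)
  have hrect : (volume.restrict (Icc α β)).prod (volume.restrict (Icc (0 : ℝ) t)) =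
      (volume.prod volume).restrict (Icc α β ×ˢ Icc 0 t) := Measure.prod_restrict _ _
  have hfin : (volume.prod volume) (Icc α β ×ˢ Icc (0 : ℝ) t) ≠ ⊤ := by
    rw [Measure.prod_prod]; exact ENNReal.mul_ne_top measure_Icc_lt_top.ne measure_Icc_lt_top.ne
  have hfi : Integrable f ((volume.restrict (Icc α β)).prod (volume.restrict (Icc (0 : ℝ) t))) := by
    rw [hrect]
    refine Measure.integrableOn_of_bounded (M := K * C₂) hfin hfm.aestronglyMeasurable ?_
    rw [ae_restrict_iff' (measurableSet_Icc.prod measurableSet_Icc)]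
    refine Filter.Eventually.of_forall fun p hp => ?_
    rw [Real.norm_eq_abs, hf, abs_mul]
    exact mul_le_mul (hK p.1 hp.1 p.2 hp.2) (hFb p.2) (abs_nonneg _) hK0
  refine ⟨hfi.integral_prod_left, ?_⟩
  -- swap and integrate the weight in `τ'`
  have hswap := MeasureTheory.integral_integral_swap (f := fun τ' s => W (τ', s) * F s) hfi
  simp only [hW] at hswap
  rw [hswap]
  refine setIntegral_congr_fun measurableSet_Icc fun s _ => ?_
  rw [MeasureTheory.integral_mul_const, integral_weight_tau hαβ Δ s]

/-! ## The windowed Grönwall lemma -/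

/-- **Weighted lower bound.** If `F ≥ 0` and the averaged weight `ζ((β+Δ−s)/Δ) − ζ((α+Δ−s)/Δ)` is at least
`m` on a measurable `J ⊆ [0,t]` (`α ≤ β`), then `m ∫_J F ≤ ∫_{[0,t]} (ζ((β+Δ−·)/Δ) − ζ((α+Δ−·)/Δ)) F`.
[folklore] -/
theorem weighted_lower_bound {F : ℝ → ℝ} (hF : Measurable F) {C₂ : ℝ} (hF0 : ∀ s, 0 ≤ F s)
    (hFb : ∀ s, |F s| ≤ C₂) {α β t Δ m : ℝ} (hαβ : α ≤ β) (hΔ : 0 < Δ) {J : Set ℝ}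
    (hJ : MeasurableSet J) (hJt : J ⊆ Icc 0 t)
    (hJm : ∀ s ∈ J, m ≤ Real.smoothTransition ((β + Δ - s) / Δ) - Real.smoothTransition ((α + Δ - s) / Δ)) :
    m * ∫ s in J, F s ≤ ∫ s in Icc 0 t, (Real.smoothTransition ((β + Δ - s) / Δ) -
        Real.smoothTransition ((α + Δ - s) / Δ)) * F s := by
  have hC₂ : 0 ≤ C₂ := (abs_nonneg _).trans (hFb 0)
  have hFi : ∀ S : Set ℝ, volume S ≠ ⊤ → IntegrableOn F S volume := fun S hS =>
    Measure.integrableOn_of_bounded (M := C₂) hS hF.aestronglyMeasurable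
      (Filter.Eventually.of_forall fun s => by rw [Real.norm_eq_abs]; exact hFb s)
  set g : ℝ → ℝ := fun s => Real.smoothTransition ((β + Δ - s) / Δ) -
    Real.smoothTransition ((α + Δ - s) / Δ) with hg
  have hgc : Continuous g := by simp only [hg]; fun_prop
  have hg0 : ∀ s, 0 ≤ g s := fun s => by
    simp only [hg, sub_nonneg]
    exact Real.smoothTransition.monotone (div_le_div_of_nonneg_right (by linarith) hΔ.le)
  have hg1 : ∀ s, g s ≤ 1 := fun s => by
    simp only [hg]
    linarith [Real.smoothTransition.le_one ((β + Δ - s) / Δ),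
      Real.smoothTransition.nonneg ((α + Δ - s) / Δ)]
  -- `m · 1_J · F ≤ g · F` on `[0, t]`
  have hgi : IntegrableOn (fun s => g s * F s) (Icc 0 t) volume := by
    refine Measure.integrableOn_of_bounded (M := C₂) measure_Icc_lt_top.ne
      ((hgc.measurable.mul hF).aestronglyMeasurable) (Filter.Eventually.of_forall fun s => ?_)
    rw [Real.norm_eq_abs, abs_mul, abs_of_nonneg (hg0 s)]
    calc g s * |F s| ≤ 1 * |F s| := mul_le_mul_of_nonneg_right (hg1 s) (abs_nonneg _)
      _ ≤ C₂ := by rw [one_mul]; exact hFb s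
  have hind : IntegrableOn (fun s => J.indicator (fun s => m * F s) s) (Icc 0 t) volume := by
    have hFt : Integrable (fun s => m * F s) (volume.restrict (Icc (0 : ℝ) t)) :=
      (hFi _ measure_Icc_lt_top.ne).const_mul m
    exact hFt.indicator hJ
  calc m * ∫ s in J, F s = ∫ s in J, m * F s := (MeasureTheory.integral_const_mul m _).symm
    _ = ∫ s in Icc 0 t, J.indicator (fun s => m * F s) s := by
        rw [integral_indicator hJ, Measure.restrict_restrict hJ, inter_eq_self_of_subset_left hJt]
    _ ≤ ∫ s in Icc 0 t, g s * F s := by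
        refine setIntegral_mono_on hind hgi measurableSet_Icc fun s _ => ?_
        by_cases hs : s ∈ J
        · rw [indicator_of_mem hs]
          exact mul_le_mul_of_nonneg_right (hJm s hs) (hF0 s)
        · rw [indicator_of_notMem hs]
          exact mul_nonneg (hg0 s) (hF0 s)

/-- REGISTERED SUB-GOAL `stub_bf18ShellWeights` of the line `Sketch` (helper 2a of `stub_bf18Shell`): averaging
the weighted integrals over the window start recovers the difference of two cut-offs as weight. [folklore] -/
theorem stub_bf18ShellWeights :
    ∀ (F : ℝ → ℝ) (C₂ α β t Δ : ℝ), Measurable F → (∀ s, |F s| ≤ C₂) → α ≤ β →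
      ∫ τ' in Set.Icc α β, ∫ s in Set.Icc 0 t,
          -deriv (fun s' => Real.smoothTransition ((τ' + Δ - s') / Δ)) s * F s =
        ∫ s in Set.Icc 0 t, (Real.smoothTransition ((β + Δ - s) / Δ) -
          Real.smoothTransition ((α + Δ - s) / Δ)) * F s :=
  fun _F _C₂ _α _β t Δ hF hFb hαβ => (integral_integral_weight hF hFb hαβ t Δ).2

end Summit.AtomisticToContinuum.HydrodynamicLimit.Theorems.ChaosClosesEulerShell
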